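import Summits.AtomisticToContinuum.Crystallization.Theorems.OverbindingBudgetAffineRunCutWalk

/-!
# `OverbindingBudget` / crux `RobustDefectLimitWindows` (stmt-AtomisticToContinuum-31280) — «RunCut» part 23C-β «HUB»:
# EVERY h-SITE WITHIN `10 ν_i` OF A MOVER IS UNIAXIAL WITH ONE LINE AT THE MOVER

Support file (lens-4 g90; order of record (2c), `ρ₁ = 30`, `D = 13`, `c⋆ = 87/250`, windows `[0.888, 1.04]`, `(K, M) = (1.752, 1.44)`; memo
`g90/memo/HUB-g90.md`; architecture `g89/memo/ATLAS-STAR-g89.md` §1 (K1)(H), §3).  The mover hub of the extremal order: a MOVER is a site `i` with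
`dist(y i, y j) ≤ 5/2 ν_j`; an h-SITE of the hub is a site `m` with `P_m = hcp` and `dist(y m, y i) ≤ 10 ν_i`.
* §1 glue: sign flips, the unit norm of a delivered line read off its closeness to a unit axis (`unit_of_near`), budgets at `≤ 17` bonds.
* §2 (section `Atlas`, the chart datum of parts 22A–23C-α verbatim, `ρ₁ ≥ 30`):
  `engine_kill` = the engine `…RunCutSheetCrossing.no_crossing` AT THE RECORD INSTANCE `(D, lo, hi, c, K, M) = (13, 0.888, 1.04, 87/250, 1.752, 1.44)`
  (side conditions `0.652·1.752² = 2.0013 ≥ 2`, `0.652·1.44² = 1.3520 ≥ 1.348`, `1.752·13 + 6.71·1.04 = 29.754 ≤ 30 ≤ ρ₁`, `1.04 ≤ 1.1988`,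
  `2.44·13 = 31.72 ≤ 33.99`): two h-sites within `13 ν_j`, windowed, whose frame axes read `|cos| ≤ 87/250` cannot coexist.
  `leg_delivers` = one leg of the hub: 23C-α `hub_leg` (chain `m → i`, `≤ 17` bonds, sites within `13 ν_j`, windowed) fed to 23B-β `leg_carry`; its KILL branch
  (`|⟪N_m, N_{c t}⟫| ≤ 1/3 + 246/10⁵ + t·33/10⁵ ≤ 0.3414 ≤ 87/250`, both sites windowed and within `13 ν_j`) is closed by `engine_kill`, so every leg DELIVERS:
  at the mover a member `X` («fcc ∧ `X ∈ XF`» or «hcp ∧ `X ∈ XHax`») with `‖û_i(X) ∓ N_m‖ ≤ 17·33/10⁵`, and if the mover is hcp,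
  `‖N_i ∓ N_m‖ ≤ 17·33/10⁵`.
  ★★★ `hub_uniaxial` — THE HUB DICHOTOMY: hcp mover ⇒ every h-site is aligned with `N_i`; fcc mover ⇒ fix one h-site's delivered line `û₀`:
  any other h-site delivers `±û₀` (aligned, 23B-β `hub_fcc_lines`) or a line at `|cos| ≤ 1/3 + 246/10⁵` from it — then the two source axes cross
  within `1/3 + 246/10⁵ + 34·33/10⁵ = 0.3470 ≤ 87/250` (23B-β `legs_cross`, `cos_budget`) and `engine_kill` closes it.  OUTPUT (the ∃-n uniaxiality of
  ATLAS-STAR §3): `∃ n, ‖n‖ = 1 ∧ ∀ h-site m of the hub, ∃ τ = ±1, ‖N_m − τ n‖ ≤ 17·33/10⁵` (`= 0.00561 ≤ 1/100`, `hub_uniaxial_hundredth`).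
[this file: 0 definitions; imports `…RunCutWalk` (23C-α) only; standard axioms]
-/

namespace Summit.AtomisticToContinuum.Crystallization.Theorems.OverbindingBudgetAffineRunCutHub

open scoped InnerProductSpace
open Literature.Geometry.DiscreteGeometry
open Summit.AtomisticToContinuum.Crystallization.Theorems.OverbindingBudgetAffineCompressedCutKernel (T3)
open Summit.AtomisticToContinuum.Crystallization.Theorems.OverbindingBudgetAffineCompressedCutCharts (mv mv_injective listedBy_fcc listedBy_hcp)
open Summit.AtomisticToContinuum.Crystallization.Theorems.OverbindingBudgetAffineCompressedCutEstablish (nearestDist_pos_of_frame)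
open Summit.AtomisticToContinuum.Crystallization.Theorems.OverbindingBudgetAffineRunCutSheetCrossing (no_crossing unit_axis axis_flip)
open Summit.AtomisticToContinuum.Crystallization.Theorems.OverbindingBudgetAffineRunCutStarKernel (XF XHax)
open Summit.AtomisticToContinuum.Crystallization.Theorems.OverbindingBudgetAffineRunCutLeg (leg_carry hub_fcc_lines legs_cross cos_budget)
open Summit.AtomisticToContinuum.Crystallization.Theorems.OverbindingBudgetAffineRunCutWalk (hub_leg)

variable {N : ℕ}
local notation "E3" => EuclideanSpace ℝ (Fin 3)

/-! ## §1 Glue and budgets at `≤ 17` bonds -/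

/-- The opposite sign is a sign. [formal bookkeeping] -/
theorem neg_sign {σ : ℝ} (hσ : σ = 1 ∨ σ = -1) : -σ = 1 ∨ -σ = -1 := by
  rcases hσ with rfl | rfl <;> norm_num

/-- Reading a closeness through the antipode: `‖−u − σ v‖ = ‖u − (−σ) v‖`. [formal bookkeeping] -/
theorem flip_neg {u v : E3} {σ δ : ℝ} (h : ‖-u - σ • v‖ ≤ δ) : ‖u - (-σ) • v‖ ≤ δ := by
  have e : -u - σ • v = -(u - (-σ) • v) := by rw [neg_smul]; abel
  rwa [e, norm_neg] at h

/-- A normalised vector within `δ < 1` of a unit axis (up to sign) IS a unit vector (the unnormalised vector cannot vanish). [this file] -/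
theorem unit_of_near {v w : E3} {σ δ : ℝ} (hw : ‖w‖ = 1) (hσ : σ = 1 ∨ σ = -1) (h : ‖(‖v‖⁻¹) • v - σ • w‖ ≤ δ) (hδ : δ < 1) :
    ‖(‖v‖⁻¹) • v‖ = 1 := by
  by_cases hv : v = 0
  · exfalso
    rw [hv, smul_zero, zero_sub, norm_neg, norm_smul, hw, mul_one] at h
    rcases hσ with rfl | rfl <;> norm_num at h <;> linarith
  · rw [norm_smul, norm_inv, norm_norm, inv_mul_cancel₀ (norm_ne_zero_iff.2 hv)]

/-- KILL budget of one leg: `t ≤ 17` carried bonds read `1/3 + 246/10⁵ + t·33/10⁵ ≤ 0.3414033 ≤ 87/250` (23B-β `cos_budget` with `t′ = 0`). [this file] -/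
theorem kill_budget {t : ℕ} (ht : t ≤ 17) : 1 / 3 + 246 / 10 ^ 5 + (t : ℝ) * (33 / 10 ^ 5) ≤ 87 / 250 := by
  have h := cos_budget (t := t) (t' := 0) (by omega)
  push_cast at h
  linarith

/-- UNIAXIALITY at `≤ 17` bonds: `t·33/10⁵ ≤ 17·33/10⁵`. [formal bookkeeping] -/
theorem uniax_le {t : ℕ} (ht : t ≤ 17) : (t : ℝ) * (33 / 10 ^ 5) ≤ 17 * (33 / 10 ^ 5) := by
  have h := (Nat.cast_le (α := ℝ)).2 ht
  push_cast at h
  linarith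

/-- The two model patterns differ (`mv (0,0,−6)` is fcc-listed, not hcp-listed). [private twin of `…CompressedCutSeed.fcc_ne_hcp`, not importable here] -/
private theorem fcc_ne_hcp' : fccTwoShellPattern ≠ hcpTwoShellPattern := by
  intro h
  have h1 : mv (0, 0, -6) ∈ fccTwoShellPattern := listedBy_fcc.2 _ (by decide)
  rw [h] at h1
  obtain ⟨W, hW, hW'⟩ := listedBy_hcp.1 _ h1
  have hW0 : W = (0, 0, -6) := mv_injective hW'.symm
  rw [hW0] at hW
  exact absurd hW (by decide)

section Atlas
/-! ONE chart datum on the ball `B(y j, ρ₁ ν_j)` (verbatim §2 of part 22A). -/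
variable {y : Fin N → E3} (hy : Function.Injective y) {j : Fin N} {ρ₁ : ℝ}
  {Ac : Fin N → (E3 →ₗ[ℝ] E3)} {Qc : Fin N → (E3 →ₗᵢ[ℝ] E3)} {Pc : Fin N → Finset E3} {fc : Fin N → E3 → E3}
  (hP : ∀ i, dist (y i) (y j) ≤ ρ₁ * nearestDist y j → Pc i = fccTwoShellPattern ∨ Pc i = hcpTwoShellPattern)
  (hA : ∀ i, dist (y i) (y j) ≤ ρ₁ * nearestDist y j → ∀ v ∈ Pc i, ‖Ac i v - Qc i v‖ ≤ 1 / 1000)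
  (hf : ∀ i, dist (y i) (y j) ≤ ρ₁ * nearestDist y j → ∀ v ∈ Pc i,
    fc i v ∈ Set.range y ∧ dist (fc i v) (y i + nearestDist y i • Ac i v) ≤ 1 / 10 ^ 4 * nearestDist y i)
  (hinj : ∀ i, dist (y i) (y j) ≤ ρ₁ * nearestDist y j → Set.InjOn (fc i) ↑(Pc i))
  (hex : ∀ i, dist (y i) (y j) ≤ ρ₁ * nearestDist y j → ∀ k : Fin N, k ≠ i →
    dist (y k) (y i) ≤ (3 / 2 + 1 / 450) * nearestDist y i → ∃ v ∈ Pc i, fc i v = y k)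

include hy hP hA hf hinj hex

/-! ## §2 The engine at the record instance, one leg, the hub -/

/-- ★ **KILL = THE ENGINE AT THE RECORD INSTANCE** `(D, lo, hi, c, K, M) = (13, 0.888, 1.04, 87/250, 1.752, 1.44)`, `ρ₁ ≥ 30`: two h-sites of the ball
within `13 ν_j` of `y j`, with scales in `[0.888 ν_j, 1.04 ν_j]`, whose frame axes read `|⟪N_a, N_b⟫| ≤ 87/250`, do not exist.
[glue over `…RunCutSheetCrossing.no_crossing`; the five numeric side conditions by `norm_num`] -/
theorem engine_kill (hρ : 30 ≤ ρ₁) (hνj : 0 < nearestDist y j) {a b : Fin N} (ha : dist (y a) (y j) ≤ ρ₁ * nearestDist y j)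
    (hPa : Pc a = hcpTwoShellPattern) (hb : dist (y b) (y j) ≤ ρ₁ * nearestDist y j) (hPb : Pc b = hcpTwoShellPattern)
    (hDa : dist (y a) (y j) ≤ 13 * nearestDist y j) (hDb : dist (y b) (y j) ≤ 13 * nearestDist y j)
    (hloa : 888 / 1000 * nearestDist y j ≤ nearestDist y a) (hhia : nearestDist y a ≤ 104 / 100 * nearestDist y j)
    (hlob : 888 / 1000 * nearestDist y j ≤ nearestDist y b) (hhib : nearestDist y b ≤ 104 / 100 * nearestDist y j) {na nb : E3}
    (hna : na = (‖Ac a ((Real.sqrt 18)⁻¹ • intVec ![4, 4, 4])‖⁻¹ • Ac a ((Real.sqrt 18)⁻¹ • intVec ![4, 4, 4]) : E3))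
    (hnb : nb = (‖Ac b ((Real.sqrt 18)⁻¹ • intVec ![4, 4, 4])‖⁻¹ • Ac b ((Real.sqrt 18)⁻¹ • intVec ![4, 4, 4]) : E3))
    (hc : |⟪na, nb⟫_ℝ| ≤ 87 / 250) : False :=
  no_crossing hy hP hA hf hinj hex ha hPa hb hPb hνj (K := 1752 / 1000) (M := 144 / 100) hDa hDb hna hnb hc le_rfl hloa hhia hlob hhib
    (by norm_num) (by norm_num) (by norm_num) (by norm_num) (by linarith) (by norm_num) (by norm_num)

/-- ★★ **ONE LEG OF THE HUB DELIVERS.**  `ρ₁ ≥ 30`, a mover `i`, an h-site `m` of its hub: `m` is in the ball, within `13 ν_j`, windowed; and for some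
`n ≤ 17`: if the mover is hcp its axis is within `n·33/10⁵` of `±N_m`, and in any case the mover holds a member `X` («fcc ∧ `X ∈ XF`» or «hcp ∧ `X ∈ XHax`»)
with `‖û_i(X) ∓ N_m‖ ≤ n·33/10⁵`.  (23C-α `hub_leg` + 23B-β `leg_carry`; the KILL branch — `c 0 = m` and the h-site `c t`, both windowed and within `13 ν_j`,
reading `|cos| ≤ 1/3 + 246/10⁵ + 17·33/10⁵ ≤ 87/250` — is closed by `engine_kill`.) [this file] -/
theorem leg_delivers (hρ : 30 ≤ ρ₁) {i : Fin N} (hi : dist (y i) (y j) ≤ 5 / 2 * nearestDist y j) {nA : Fin N → E3}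
    (hnA : ∀ k, nA k = (‖Ac k ((Real.sqrt 18)⁻¹ • intVec ![4, 4, 4])‖⁻¹) • Ac k ((Real.sqrt 18)⁻¹ • intVec ![4, 4, 4]))
    {m : Fin N} (hPm : Pc m = hcpTwoShellPattern) (hm : dist (y m) (y i) ≤ 10 * nearestDist y i) :
    (dist (y m) (y j) ≤ 13 * nearestDist y j ∧ dist (y m) (y j) ≤ ρ₁ * nearestDist y j ∧
      888 / 1000 * nearestDist y j ≤ nearestDist y m ∧ nearestDist y m ≤ 104 / 100 * nearestDist y j) ∧
    ∃ n : ℕ, n ≤ 17 ∧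
      (Pc i = hcpTwoShellPattern → ∃ σ : ℝ, (σ = 1 ∨ σ = -1) ∧ ‖nA i - σ • nA m‖ ≤ (n : ℝ) * (33 / 10 ^ 5)) ∧
      ∃ X : T3, ((Pc i = fccTwoShellPattern ∧ X ∈ XF) ∨ (Pc i = hcpTwoShellPattern ∧ X ∈ XHax)) ∧
        ∃ σ : ℝ, (σ = 1 ∨ σ = -1) ∧ ‖(‖Ac i ((1 / 3 : ℝ) • mv X)‖⁻¹) • Ac i ((1 / 3 : ℝ) • mv X) - σ • nA m‖ ≤ (n : ℝ) * (33 / 10 ^ 5) := by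
  have hj0 : dist (y j) (y j) ≤ ρ₁ * nearestDist y j := by
    rw [dist_self]; exact mul_nonneg (by linarith) (nearestDist_nonneg _ _)
  have hνj : 0 < nearestDist y j := nearestDist_pos_of_frame hy (hP _ hj0) (fun v hv => (hf _ hj0 v hv).1) (hinj _ hj0)
  obtain ⟨n, hn, c, u, hcm, hcn, hch, hw⟩ := hub_leg hy hP hA hf hinj hex hρ hi hm
  have hball : ∀ t ≤ n, dist (y (c t)) (y j) ≤ ρ₁ * nearestDist y j := fun t ht => (hw t ht).2.1
  have h0 : Pc (c 0) = hcpTwoShellPattern := by rw [hcm]; exact hPm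
  obtain ⟨hD0, hb0, hlo0, hhi0⟩ := hw 0 (Nat.zero_le n)
  rcases leg_carry hy hP hA hf hinj hex c u hnA h0 n hball hch with ⟨t, -, htn, hPt, hcos⟩ | ⟨halign, X, hX, σ, hσ, hdist⟩
  · obtain ⟨hDt, hbt, hlot, hhit⟩ := hw t htn
    exact (engine_kill hy hP hA hf hinj hex hρ hνj hb0 h0 hbt hPt hD0 hDt hlo0 hhi0 hlot hhit (hnA _) (hnA _)
      (hcos.trans (kill_budget (htn.trans hn)))).elim
  · rw [hcm] at hD0 hb0 hlo0 hhi0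
    have hal : Pc i = hcpTwoShellPattern → ∃ σ : ℝ, (σ = 1 ∨ σ = -1) ∧ ‖nA i - σ • nA m‖ ≤ (n : ℝ) * (33 / 10 ^ 5) := by
      intro hPi
      have h := halign n le_rfl (by rw [hcn]; exact hPi)
      rw [hcn, hcm] at h
      exact h
    rw [hcn] at hX hdist
    rw [hcm] at hdist
    exact ⟨⟨hD0, hb0, hlo0, hhi0⟩, n, hn, hal, X, hX, σ, hσ, hdist⟩

/-- ★★★ **THE HUB IS UNIAXIAL.**  `ρ₁ ≥ 30`; a mover `i` (`dist(y i, y j) ≤ 5/2 ν_j`): there is ONE unit vector `n` such that every h-site `m` of the hub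
(`P_m = hcp`, `dist(y m, y i) ≤ 10 ν_i`) has its frame axis within `17·33/10⁵ = 0.00561` of `±n`.  hcp mover: `n := N_i` and `leg_delivers`' alignment clause.
fcc mover: no h-site — any unit vector; else `n := û₀`, the line delivered by one h-site `m₀` (a unit vector by `unit_of_near`): another h-site `m`
delivers `û = ±û₀` (23B-β `hub_fcc_lines`; aligned after a sign flip) or `|⟪û₀, û⟫| ≤ 1/3 + 246/10⁵`, and then `|⟪N_{m₀}, N_m⟫| ≤ 1/3 + 246/10⁵ +
34·33/10⁵ ≤ 87/250` (23B-β `legs_cross`, `cos_budget`) is closed by `engine_kill`. [this file] -/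
theorem hub_uniaxial (hρ : 30 ≤ ρ₁) {i : Fin N} (hi : dist (y i) (y j) ≤ 5 / 2 * nearestDist y j) {nA : Fin N → E3}
    (hnA : ∀ k, nA k = (‖Ac k ((Real.sqrt 18)⁻¹ • intVec ![4, 4, 4])‖⁻¹) • Ac k ((Real.sqrt 18)⁻¹ • intVec ![4, 4, 4])) :
    ∃ n : E3, ‖n‖ = 1 ∧ ∀ m : Fin N, Pc m = hcpTwoShellPattern → dist (y m) (y i) ≤ 10 * nearestDist y i →
      ∃ τ : ℝ, (τ = 1 ∨ τ = -1) ∧ ‖nA m - τ • n‖ ≤ 17 * (33 / 10 ^ 5) := by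
  have hj0 : dist (y j) (y j) ≤ ρ₁ * nearestDist y j := by
    rw [dist_self]; exact mul_nonneg (by linarith) (nearestDist_nonneg _ _)
  have hνj : 0 < nearestDist y j := nearestDist_pos_of_frame hy (hP _ hj0) (fun v hv => (hf _ hj0 v hv).1) (hinj _ hj0)
  have hi0 : dist (y i) (y j) ≤ ρ₁ * nearestDist y j := hi.trans (mul_le_mul_of_nonneg_right (by linarith) hνj.le)
  have hN : ∀ m : Fin N, dist (y m) (y j) ≤ ρ₁ * nearestDist y j → Pc m = hcpTwoShellPattern → ‖nA m‖ = 1 := by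
    intro m hm hPm
    rw [hnA]
    exact (unit_axis hy hA hf hinj hex hm hPm).1
  rcases hP i hi0 with hPi | hPi
  · -- fcc mover
    by_cases hex0 : ∃ m₀ : Fin N, Pc m₀ = hcpTwoShellPattern ∧ dist (y m₀) (y i) ≤ 10 * nearestDist y i
    · obtain ⟨m₀, hPm₀, hm₀⟩ := hex0
      obtain ⟨⟨hD₀, hb₀, hlo₀, hhi₀⟩, n₀, hn₀, -, X₀, hX₀, σ₀, hσ₀, hd₀⟩ := leg_delivers hy hP hA hf hinj hex hρ hi hnA hPm₀ hm₀
      have hX₀F : X₀ ∈ XF := by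
        rcases hX₀ with ⟨-, h⟩ | ⟨h, -⟩
        · exact h
        · exact absurd (hPi.symm.trans h) fcc_ne_hcp'
      have hN₀ : ‖nA m₀‖ = 1 := hN m₀ hb₀ hPm₀
      have hlt : (n₀ : ℝ) * (33 / 10 ^ 5) < 1 := by linarith [uniax_le hn₀]
      have hû₀ : ‖(‖Ac i ((1 / 3 : ℝ) • mv X₀)‖⁻¹) • Ac i ((1 / 3 : ℝ) • mv X₀)‖ = 1 := unit_of_near hN₀ hσ₀ hd₀ hlt
      refine ⟨(‖Ac i ((1 / 3 : ℝ) • mv X₀)‖⁻¹) • Ac i ((1 / 3 : ℝ) • mv X₀), hû₀, fun m hPm hm => ?_⟩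
      obtain ⟨⟨hD, hb, hlo, hhi⟩, n, hn, -, X, hX, σ, hσ, hd⟩ := leg_delivers hy hP hA hf hinj hex hρ hi hnA hPm hm
      have hXF : X ∈ XF := by
        rcases hX with ⟨-, h⟩ | ⟨h, -⟩
        · exact h
        · exact absurd (hPi.symm.trans h) fcc_ne_hcp'
      rcases hub_fcc_lines hA hi0 hPi hX₀F hXF with (he | he) | hcos
      · rw [he] at hd
        exact ⟨σ, hσ, (axis_flip hσ hd).trans (uniax_le hn)⟩
      · rw [he] at hd
        exact ⟨-σ, neg_sign hσ, (axis_flip (neg_sign hσ) (flip_neg hd)).trans (uniax_le hn)⟩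
      · have hcross := legs_cross hû₀ (hN m hb hPm) hσ₀ hσ hd₀ hd hcos
        exact (engine_kill hy hP hA hf hinj hex hρ hνj hb₀ hPm₀ hb hPm hD₀ hD hlo₀ hhi₀ hlo hhi (hnA _) (hnA _)
          (hcross.trans (cos_budget (t := n₀) (t' := n) (by omega)))).elim
    · refine ⟨EuclideanSpace.single 0 1, by rw [PiLp.norm_single, norm_one], fun m hPm hm => ?_⟩
      exact absurd ⟨m, hPm, hm⟩ hex0
  · -- hcp mover
    refine ⟨nA i, hN i hi0 hPi, fun m hPm hm => ?_⟩
    obtain ⟨-, n, hn, hal, -⟩ := leg_delivers hy hP hA hf hinj hex hρ hi hnA hPm hm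
    obtain ⟨σ, hσ, h⟩ := hal hPi
    exact ⟨σ, hσ, (axis_flip hσ h).trans (uniax_le hn)⟩

/-- ★★★ **THE HUB IS UNIAXIAL TO `1/100`** (the tolerance of ATLAS-STAR §3 / 24 «UNIAX»: `17·33/10⁵ = 0.00561 ≤ 1/100`). [this file] -/
theorem hub_uniaxial_hundredth (hρ : 30 ≤ ρ₁) {i : Fin N} (hi : dist (y i) (y j) ≤ 5 / 2 * nearestDist y j) {nA : Fin N → E3}
    (hnA : ∀ k, nA k = (‖Ac k ((Real.sqrt 18)⁻¹ • intVec ![4, 4, 4])‖⁻¹) • Ac k ((Real.sqrt 18)⁻¹ • intVec ![4, 4, 4])) :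
    ∃ n : E3, ‖n‖ = 1 ∧ ∀ m : Fin N, Pc m = hcpTwoShellPattern → dist (y m) (y i) ≤ 10 * nearestDist y i →
      ∃ τ : ℝ, (τ = 1 ∨ τ = -1) ∧ ‖nA m - τ • n‖ ≤ 1 / 100 := by
  obtain ⟨n, hn, h⟩ := hub_uniaxial hy hP hA hf hinj hex hρ hi hnA
  refine ⟨n, hn, fun m hPm hm => ?_⟩
  obtain ⟨τ, hτ, hd⟩ := h m hPm hm
  exact ⟨τ, hτ, hd.trans (by norm_num)⟩

end Atlas

end Summit.AtomisticToContinuum.Crystallization.Theorems.OverbindingBudgetAffineRunCutHub
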